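import Mathlib
import HarnessLib
import Summits.Ventures.LatticeQCDFlow.Exactness.NCMCGeneralSpaceRestartChainCLT
import Summits.Ventures.LatticeQCDFlow.Exactness.NCMCGeneralSpaceRestartChainVarianceDichotomy
import Summits.Ventures.LatticeQCDFlow.Exactness.NCMCGeneralSpaceReplicaTStatisticIndep

/-!
# The engine's `free_energy ± jackknife` bar over `R` independent streams of CORRELATED launches: its limiting coverage is `L_R(q)` — for every protocol with bounded-below non-exact work, every minorised level sampler and EVERY family of starts

HONEST FRAMING: exact (Metropolis-corrected) sampling algorithms for lattice gauge theory;
figures of merit are autocorrelation/cost numbers at stated couplings and volumes; no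
continuum-physics claim.

Venture `LatticeQCDFlow` (cell pub-lqcd), topic `Exactness`; FANOUT row 13 (`eng-snf`, GEN-24).  NEW
WORK of the cell — the composition of GEN-22 `CrooksPair.tendstoInDistribution_jarzynskiEstimate_
restartChain` (the Jarzynski lane's CLT along the restart chain from EVERY initial record law, work
`−B ≤ W`), GEN-23 V `CrooksPair.greenKubo_variance_exp_neg_work_restartChain_pos_iff` (`σ²_w > 0`
iff the protocol is not `P_F`-a.s. exact) and GEN-23 I `tendsto_measure_abs_studentised_le_of_indep`
(the "independent runs" bar of ANY asymptotically normal estimator has the limiting coverage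
`L_R(q) = N(0,1)^{⊗R}{|t| ≤ q}`).  No definition; nothing cited as a fact.

WHY (row 13).  `latflow-snf`'s `estimators.free_energy` run over a batch of `R` streams — each
stream a sequence of `n` switch records launched off ONE equilibrium simulation of the level sampler
`K` (correlated starts), the streams independent of each other (own seeds / launch configurations)
— prints the replica mean `ΔF̄̂_n = (1/R) Σ_r ΔF̂_{r,n}` with the between-stream (jackknife /
"independent runs") standard error `ŝe_n = √(Σ_r (ΔF̂_{r,n} − ΔF̄̂_n)²/(R(R−1)))`.  This file types
what that bar means at fixed `R ≥ 2`: for EVERY family of initial record laws (in particular every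
family of launch configurations), `P(|ΔF̄̂_n − ΔF| ≤ q ŝe_n) → L_R(q)` — ONE limit, a function of
`(R, q)` only (GEN-24 `NCMCGeneralSpaceReplicaTStatisticStudent`: the two-sided Student-ratio
probability; `NCMCGeneralSpaceReplicaTStatisticTwoReplicas`: `(2/π)·arctan q` at `R = 2`), so the
bar is calibrated iff `q` is that law's quantile, NOT the normal one.  The same holds for every
bounded record diagnostic printed next to `dF` (mean work, mean switch acceptance: §2).

## Content
* **`CrooksPair.tendsto_measure_abs_jarzynskiReplicaT_le_restartChains`** (§1) — Crooks pair,
  `Z₀ ≠ 0`, `e^{−ΔF} = Z₁/Z₀`, `−B ≤ W`, `K` Markov `ν₀`-invariant dominating a non-zero finite `m`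
  from every configuration, `σ²_w > 0` (Green–Kubo variance of `e^{−W}` along the restart chain),
  `R ≥ 2` INDEPENDENT restart chains with ANY initial record laws `μ_r`, `q ≥ 0`:
  `P(|(ΔF̄̂_n − ΔF)/ŝe_n| ≤ q) → L_R(q)`.
* **`…_of_variance`** — the same with `σ²_w > 0` replaced by the checkable
  `0 < ∫ (e^{−W} − Z₁/Z₀)² dP_F` (the protocol is not a.s. exact); **`…_everyStart`** — stream `r`
  launched from ANY configuration `x_r` (`μ_r = κF(x_r, ·)`).
* **`CrooksPair.tendsto_measure_abs_observableReplicaT_le_restartChains`** (§2) — any bounded record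
  observable `g` (`|g| ≤ C`) with `σ²_g > 0`: the replica-`t` bar of the stream means of `g` has
  limiting coverage `L_R(q)`.

NOT CLAIMED: unbounded work; `R → ∞`; dependent streams (branched off one run); the VALUE of
`L_R(q)` beyond the two files quoted; anything numerical.
-/

namespace Summit.Ventures.LatticeQCDFlow.Exactness.GeneralNCMC

open MeasureTheory ProbabilityTheory Set Filter Finset
open scoped ENNReal NNReal Topology

variable {Ω E : Type*} [MeasurableSpace Ω] [MeasurableSpace E]

namespace CrooksPair

variable {ν₀ ν₁ : Measure Ω} [IsFiniteMeasure ν₀] [IsFiniteMeasure ν₁] {κF κR : Kernel Ω E}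
  [IsMarkovKernel κF] [IsMarkovKernel κR] {s e : E → Ω} {W : E → ℝ}
  {ι : Type*} [Fintype ι] [Nontrivial ι]

/-- The Jarzynski estimate read off the first `n` records of a stream is a measurable function of
the stream. -/
theorem measurable_jarzynskiEstimate_run {w : E → ℝ} (hw : Measurable w) (n : ℕ) :
    Measurable fun ω : ℕ → E => jarzynskiEstimate w (fun i : Fin n => ω i) := by
  unfold jarzynskiEstimate
  exact (Real.measurable_log.comp (measurable_sampleMean_run hw n)).neg

/-! ## §1 The `free_energy` replica-jackknife bar -/

/-- **THE ENGINE'S `free_energy ± q·ŝe_JK` BAR OVER `R ≥ 2` INDEPENDENT STREAMS OF CORRELATED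
LAUNCHES HAS LIMITING COVERAGE `L_R(q)`, FROM EVERY FAMILY OF INITIAL RECORD LAWS.**  Crooks pair,
`Z₀ ≠ 0`, `e^{−ΔF} = Z₁/Z₀`, work bounded below, `K` Markov, `ν₀`-invariant, `m ≤ K(z,·)` for all
`z` (`m` finite, non-zero), `σ²_w > 0`; stream `r` has initial record law `μ_r` and the streams are
independent (law `⊗_r P_{μ_r}`); `q ≥ 0`. -/
theorem tendsto_measure_abs_jarzynskiReplicaT_le_restartChains (K : Kernel Ω Ω) [IsMarkovKernel K]
    (h0 : ν₀ univ ≠ 0) (hK : Kernel.Invariant K ν₀) (h : CrooksPair ν₀ ν₁ κF κR s e W) {ΔF : ℝ}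
    (hΔF : Real.exp (-ΔF) = ((ν₀ univ)⁻¹ * ν₁ univ).toReal) {m : Measure Ω} [IsFiniteMeasure m]
    (hm0 : m univ ≠ 0) (hmin : ∀ z, m ≤ K z) {B : ℝ} (hB : ∀ ω, -B ≤ W ω)
    (hσ : 0 < Scoring.autocov ((κF ∘ₖ K).comap s h.measurable_s) (fwdPathLaw ν₀ κF)
          (fun ω => Real.exp (-W ω) - ((ν₀ univ)⁻¹ * ν₁ univ).toReal) 0
        + 2 * ∑' t, Scoring.autocov ((κF ∘ₖ K).comap s h.measurable_s) (fwdPathLaw ν₀ κF)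
          (fun ω => Real.exp (-W ω) - ((ν₀ univ)⁻¹ * ν₁ univ).toReal) (t + 1))
    (μ : ι → Measure E) [∀ r, IsProbabilityMeasure (μ r)]
    [∀ r, IsProbabilityMeasure (Kernel.trajMeasure (X := fun _ : ℕ => E) (μ r)
        (fun n : ℕ => ((κF ∘ₖ K).comap s h.measurable_s).comap
          (fun hh : (j : ↥(Finset.Iic n)) → E => hh ⟨n, Finset.mem_Iic.2 le_rfl⟩)
          (measurable_pi_apply _)))] {q : ℝ} (hq : 0 ≤ q) :
    Tendsto (fun n : ℕ => (Measure.pi fun r => Kernel.trajMeasure (X := fun _ : ℕ => E) (μ r)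
        (fun n : ℕ => ((κF ∘ₖ K).comap s h.measurable_s).comap
          (fun hh : (j : ↥(Finset.Iic n)) → E => hh ⟨n, Finset.mem_Iic.2 le_rfl⟩)
          (measurable_pi_apply _)))
        {ω : ι → ℕ → E |
          |((∑ r, jarzynskiEstimate (fun ε => Real.exp (-W ε)) (fun i : Fin n => ω r i))
              / Fintype.card ι - ΔF)
            / Real.sqrt ((∑ r,
                (jarzynskiEstimate (fun ε => Real.exp (-W ε)) (fun i : Fin n => ω r i)
                  - (∑ r', jarzynskiEstimate (fun ε => Real.exp (-W ε)) (fun i : Fin n => ω r' i))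
                    / Fintype.card ι) ^ 2)
              / ((Fintype.card ι : ℝ) * (Fintype.card ι - 1)))| ≤ q})
      atTop
      (𝓝 ((Measure.pi fun _ : ι => gaussianReal 0 1) {z : ι → ℝ | |(∑ r, z r) / Fintype.card ι
        / Real.sqrt ((∑ r, (z r - (∑ r', z r') / Fintype.card ι) ^ 2)
            / ((Fintype.card ι : ℝ) * (Fintype.card ι - 1)))| ≤ q})) := by
  set θ : ℝ := ((ν₀ univ)⁻¹ * ν₁ univ).toReal with hθdef
  have hθ : 0 < θ := by rw [← hΔF]; exact Real.exp_pos _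
  set σ2 : ℝ := (∫ ω, (Real.exp (-W ω) - θ) ^ 2 ∂(fwdPathLaw ν₀ κF))
      + 2 * ∑' k, ∫ ω, (Real.exp (-W ω) - θ)
        * (Scoring.kop ((κF ∘ₖ K).comap s h.measurable_s))^[k + 1]
            (fun ω => Real.exp (-W ω) - θ) ω ∂(fwdPathLaw ν₀ κF) with hσ2
  -- the Green–Kubo form of the hypothesis is the CLT's variance
  have hσ2pos : 0 < σ2 := by
    have heq : σ2 = Scoring.autocov ((κF ∘ₖ K).comap s h.measurable_s) (fwdPathLaw ν₀ κF)
          (fun ω => Real.exp (-W ω) - θ) 0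
        + 2 * ∑' t, Scoring.autocov ((κF ∘ₖ K).comap s h.measurable_s) (fwdPathLaw ν₀ κF)
          (fun ω => Real.exp (-W ω) - θ) (t + 1) := by
      rw [hσ2]
      unfold Scoring.autocov
      simp only [Function.iterate_zero, id_eq, sq]
    rw [heq]
    exact hσ
  have hv : (σ2 / θ ^ 2).toNNReal ≠ 0 := by
    rw [Ne, Real.toNNReal_eq_zero, not_le]
    exact div_pos hσ2pos (pow_pos hθ 2)
  -- per-stream CLT against the identity on `(ℝ, N(0, σ²_w/θ²))`
  have hclt : ∀ r : ι, TendstoInDistribution (fun (n : ℕ) (ω : ℕ → E) =>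
        Real.sqrt (n : ℝ)
          * (jarzynskiEstimate (fun ε => Real.exp (-W ε)) (fun i : Fin n => ω i) - ΔF))
      atTop id (fun _ => Kernel.trajMeasure (X := fun _ : ℕ => E) (μ r)
        (fun n : ℕ => ((κF ∘ₖ K).comap s h.measurable_s).comap
          (fun hh : (j : ↥(Finset.Iic n)) → E => hh ⟨n, Finset.mem_Iic.2 le_rfl⟩)
          (measurable_pi_apply _))) (gaussianReal 0 (σ2 / θ ^ 2).toNNReal) := fun r =>
    h.tendstoInDistribution_jarzynskiEstimate_restartChain K h0 hK hΔF hm0 hmin hB (μ r)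
      (P' := gaussianReal 0 (σ2 / θ ^ 2).toNNReal) (Y := id) HasLaw.id
  exact tendsto_measure_abs_studentised_le_of_indep (Ω := fun _ : ι => ℕ → E)
    (θhat := fun (_ : ι) (n : ℕ) (ω : ℕ → E) =>
      jarzynskiEstimate (fun ε => Real.exp (-W ε)) (fun i : Fin n => ω i))
    (fun _ n => measurable_jarzynskiEstimate_run (Real.measurable_exp.comp h.measurable_W.neg) n)
    ΔF hv hclt hq

/-- **The same with the variance hypothesis in checkable form**: `0 < ∫ (e^{−W} − Z₁/Z₀)² dP_F`
(the protocol is not `P_F`-a.s. exact; GEN-23 V). -/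
theorem tendsto_measure_abs_jarzynskiReplicaT_le_restartChains_of_variance (K : Kernel Ω Ω)
    [IsMarkovKernel K] (h0 : ν₀ univ ≠ 0) (hK : Kernel.Invariant K ν₀)
    (h : CrooksPair ν₀ ν₁ κF κR s e W) {ΔF : ℝ}
    (hΔF : Real.exp (-ΔF) = ((ν₀ univ)⁻¹ * ν₁ univ).toReal) {m : Measure Ω} [IsFiniteMeasure m]
    (hm0 : m univ ≠ 0) (hmin : ∀ z, m ≤ K z) {B : ℝ} (hB : ∀ ω, -B ≤ W ω)
    (hV : 0 < ∫ ω, (Real.exp (-W ω) - ((ν₀ univ)⁻¹ * ν₁ univ).toReal) ^ 2 ∂(fwdPathLaw ν₀ κF))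
    (μ : ι → Measure E) [∀ r, IsProbabilityMeasure (μ r)]
    [∀ r, IsProbabilityMeasure (Kernel.trajMeasure (X := fun _ : ℕ => E) (μ r)
        (fun n : ℕ => ((κF ∘ₖ K).comap s h.measurable_s).comap
          (fun hh : (j : ↥(Finset.Iic n)) → E => hh ⟨n, Finset.mem_Iic.2 le_rfl⟩)
          (measurable_pi_apply _)))] {q : ℝ} (hq : 0 ≤ q) :
    Tendsto (fun n : ℕ => (Measure.pi fun r => Kernel.trajMeasure (X := fun _ : ℕ => E) (μ r)
        (fun n : ℕ => ((κF ∘ₖ K).comap s h.measurable_s).comap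
          (fun hh : (j : ↥(Finset.Iic n)) → E => hh ⟨n, Finset.mem_Iic.2 le_rfl⟩)
          (measurable_pi_apply _)))
        {ω : ι → ℕ → E |
          |((∑ r, jarzynskiEstimate (fun ε => Real.exp (-W ε)) (fun i : Fin n => ω r i))
              / Fintype.card ι - ΔF)
            / Real.sqrt ((∑ r,
                (jarzynskiEstimate (fun ε => Real.exp (-W ε)) (fun i : Fin n => ω r i)
                  - (∑ r', jarzynskiEstimate (fun ε => Real.exp (-W ε)) (fun i : Fin n => ω r' i))
                    / Fintype.card ι) ^ 2)
              / ((Fintype.card ι : ℝ) * (Fintype.card ι - 1)))| ≤ q})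
      atTop
      (𝓝 ((Measure.pi fun _ : ι => gaussianReal 0 1) {z : ι → ℝ | |(∑ r, z r) / Fintype.card ι
        / Real.sqrt ((∑ r, (z r - (∑ r', z r') / Fintype.card ι) ^ 2)
            / ((Fintype.card ι : ℝ) * (Fintype.card ι - 1)))| ≤ q})) :=
  h.tendsto_measure_abs_jarzynskiReplicaT_le_restartChains K h0 hK hΔF hm0 hmin hB
    ((h.greenKubo_variance_exp_neg_work_restartChain_pos_iff K h0 hK hm0 hmin hB).2 hV) μ hq

/-- **The engine's form**: stream `r` is launched from ANY configuration `x_r` (`μ_r = κF(x_r, ·)`);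
work not `P_F`-a.s. equal to `ΔF`. -/
theorem tendsto_measure_abs_jarzynskiReplicaT_le_restartChains_everyStart (K : Kernel Ω Ω)
    [IsMarkovKernel K] (h0 : ν₀ univ ≠ 0) (hK : Kernel.Invariant K ν₀)
    (h : CrooksPair ν₀ ν₁ κF κR s e W) {ΔF : ℝ}
    (hΔF : Real.exp (-ΔF) = ((ν₀ univ)⁻¹ * ν₁ univ).toReal) {m : Measure Ω} [IsFiniteMeasure m]
    (hm0 : m univ ≠ 0) (hmin : ∀ z, m ≤ K z) {B : ℝ} (hB : ∀ ω, -B ≤ W ω)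
    (hV : 0 < ∫ ω, (Real.exp (-W ω) - ((ν₀ univ)⁻¹ * ν₁ univ).toReal) ^ 2 ∂(fwdPathLaw ν₀ κF))
    (x : ι → Ω)
    [∀ r, IsProbabilityMeasure (Kernel.trajMeasure (X := fun _ : ℕ => E) (κF (x r))
        (fun n : ℕ => ((κF ∘ₖ K).comap s h.measurable_s).comap
          (fun hh : (j : ↥(Finset.Iic n)) → E => hh ⟨n, Finset.mem_Iic.2 le_rfl⟩)
          (measurable_pi_apply _)))] {q : ℝ} (hq : 0 ≤ q) :
    Tendsto (fun n : ℕ => (Measure.pi fun r => Kernel.trajMeasure (X := fun _ : ℕ => E) (κF (x r))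
        (fun n : ℕ => ((κF ∘ₖ K).comap s h.measurable_s).comap
          (fun hh : (j : ↥(Finset.Iic n)) → E => hh ⟨n, Finset.mem_Iic.2 le_rfl⟩)
          (measurable_pi_apply _)))
        {ω : ι → ℕ → E |
          |((∑ r, jarzynskiEstimate (fun ε => Real.exp (-W ε)) (fun i : Fin n => ω r i))
              / Fintype.card ι - ΔF)
            / Real.sqrt ((∑ r,
                (jarzynskiEstimate (fun ε => Real.exp (-W ε)) (fun i : Fin n => ω r i)
                  - (∑ r', jarzynskiEstimate (fun ε => Real.exp (-W ε)) (fun i : Fin n => ω r' i))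
                    / Fintype.card ι) ^ 2)
              / ((Fintype.card ι : ℝ) * (Fintype.card ι - 1)))| ≤ q})
      atTop
      (𝓝 ((Measure.pi fun _ : ι => gaussianReal 0 1) {z : ι → ℝ | |(∑ r, z r) / Fintype.card ι
        / Real.sqrt ((∑ r, (z r - (∑ r', z r') / Fintype.card ι) ^ 2)
            / ((Fintype.card ι : ℝ) * (Fintype.card ι - 1)))| ≤ q})) :=
  h.tendsto_measure_abs_jarzynskiReplicaT_le_restartChains_of_variance K h0 hK hΔF hm0 hmin hB hV
    (fun r => κF (x r)) hq

/-! ## §2 Any bounded record diagnostic (mean work, mean switch acceptance, …) -/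

omit [IsFiniteMeasure ν₁] [IsMarkovKernel κR] in
/-- **THE REPLICA-`t` BAR OF THE STREAM MEANS OF ANY BOUNDED RECORD OBSERVABLE HAS LIMITING COVERAGE
`L_R(q)`.**  Crooks pair with `Z₀ ≠ 0`; `K` Markov `ν₀`-invariant, `m ≤ K(z,·)` (`m` finite,
non-zero);
`g` measurable, `|g| ≤ C`, with Green–Kubo variance `σ²_g > 0` along the restart chain; `R ≥ 2`
independent streams with ANY initial record laws; `q ≥ 0`:
`P(|((1/R)Σ_r ḡ_{r,n} − E_F g)/√(Σ_r (ḡ_{r,n} − ḡ̄_n)²/(R(R−1)))| ≤ q) → L_R(q)`. -/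
theorem tendsto_measure_abs_observableReplicaT_le_restartChains (K : Kernel Ω Ω) [IsMarkovKernel K]
    (h0 : ν₀ univ ≠ 0) (hK : Kernel.Invariant K ν₀) (h : CrooksPair ν₀ ν₁ κF κR s e W)
    {m : Measure Ω} [IsFiniteMeasure m] (hm0 : m univ ≠ 0) (hmin : ∀ z, m ≤ K z)
    {g : E → ℝ} (hg : Measurable g) {C : ℝ} (hC : ∀ ω, |g ω| ≤ C)
    (hσ : 0 < Scoring.autocov ((κF ∘ₖ K).comap s h.measurable_s) (fwdPathLaw ν₀ κF)
          (fun ω => g ω - ∫ z, g z ∂(fwdPathLaw ν₀ κF)) 0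
        + 2 * ∑' t, Scoring.autocov ((κF ∘ₖ K).comap s h.measurable_s) (fwdPathLaw ν₀ κF)
          (fun ω => g ω - ∫ z, g z ∂(fwdPathLaw ν₀ κF)) (t + 1))
    (μ : ι → Measure E) [∀ r, IsProbabilityMeasure (μ r)]
    [∀ r, IsProbabilityMeasure (Kernel.trajMeasure (X := fun _ : ℕ => E) (μ r)
        (fun n : ℕ => ((κF ∘ₖ K).comap s h.measurable_s).comap
          (fun hh : (j : ↥(Finset.Iic n)) → E => hh ⟨n, Finset.mem_Iic.2 le_rfl⟩)
          (measurable_pi_apply _)))] {q : ℝ} (hq : 0 ≤ q) :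
    Tendsto (fun n : ℕ => (Measure.pi fun r => Kernel.trajMeasure (X := fun _ : ℕ => E) (μ r)
        (fun n : ℕ => ((κF ∘ₖ K).comap s h.measurable_s).comap
          (fun hh : (j : ↥(Finset.Iic n)) → E => hh ⟨n, Finset.mem_Iic.2 le_rfl⟩)
          (measurable_pi_apply _)))
        {ω : ι → ℕ → E |
          |((∑ r, (∑ i ∈ range n, g (ω r i)) / n) / Fintype.card ι - ∫ z, g z ∂(fwdPathLaw ν₀ κF))
            / Real.sqrt ((∑ r, ((∑ i ∈ range n, g (ω r i)) / n
                - (∑ r', (∑ i ∈ range n, g (ω r' i)) / n) / Fintype.card ι) ^ 2)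
              / ((Fintype.card ι : ℝ) * (Fintype.card ι - 1)))| ≤ q})
      atTop
      (𝓝 ((Measure.pi fun _ : ι => gaussianReal 0 1) {z : ι → ℝ | |(∑ r, z r) / Fintype.card ι
        / Real.sqrt ((∑ r, (z r - (∑ r', z r') / Fintype.card ι) ^ 2)
            / ((Fintype.card ι : ℝ) * (Fintype.card ι - 1)))| ≤ q})) := by
  set θ : ℝ := ∫ z, g z ∂(fwdPathLaw ν₀ κF) with hθdef
  set σ2 : ℝ := (∫ ω, (g ω - θ) ^ 2 ∂(fwdPathLaw ν₀ κF))
      + 2 * ∑' k, ∫ ω, (g ω - θ)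
        * (Scoring.kop ((κF ∘ₖ K).comap s h.measurable_s))^[k + 1]
            (fun ω => g ω - θ) ω ∂(fwdPathLaw ν₀ κF) with hσ2
  have hσ2pos : 0 < σ2 := by
    have heq : σ2 = Scoring.autocov ((κF ∘ₖ K).comap s h.measurable_s) (fwdPathLaw ν₀ κF)
          (fun ω => g ω - θ) 0
        + 2 * ∑' t, Scoring.autocov ((κF ∘ₖ K).comap s h.measurable_s) (fwdPathLaw ν₀ κF)
          (fun ω => g ω - θ) (t + 1) := by
      rw [hσ2]
      unfold Scoring.autocov
      simp only [Function.iterate_zero, id_eq, sq]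
    rw [heq]
    exact hσ
  have hv : σ2.toNNReal ≠ 0 := by
    rw [Ne, Real.toNNReal_eq_zero, not_le]
    exact hσ2pos
  -- per-stream CLT for the stream mean of `g`, in the `√n (mean − θ)` form
  have hclt : ∀ r : ι, TendstoInDistribution (fun (n : ℕ) (ω : ℕ → E) =>
        Real.sqrt (n : ℝ) * ((∑ i ∈ range n, g (ω i)) / n - θ))
      atTop id (fun _ => Kernel.trajMeasure (X := fun _ : ℕ => E) (μ r)
        (fun n : ℕ => ((κF ∘ₖ K).comap s h.measurable_s).comap
          (fun hh : (j : ↥(Finset.Iic n)) → E => hh ⟨n, Finset.mem_Iic.2 le_rfl⟩)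
          (measurable_pi_apply _))) (gaussianReal 0 σ2.toNNReal) := by
    intro r
    have hc := h.tendstoInDistribution_timeAverage_restartChain K h0 hK hm0 hmin hg hC (μ r)
      (P' := gaussianReal 0 σ2.toNNReal) (Y := id) HasLaw.id
    refine hc.congr (fun n => Eventually.of_forall fun ω => ?_) Filter.EventuallyEq.rfl
    exact (sqrt_mul_mean_sub_eq (fun i => g (ω i)) θ n).symm
  have hmeas : ∀ n : ℕ, Measurable fun ω : ℕ → E => (∑ i ∈ range n, g (ω i)) / n := fun n =>
    (Finset.measurable_sum _ fun i _ => hg.comp (measurable_pi_apply i)).div_const _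
  exact tendsto_measure_abs_studentised_le_of_indep (Ω := fun _ : ι => ℕ → E)
    (θhat := fun (_ : ι) (n : ℕ) (ω : ℕ → E) => (∑ i ∈ range n, g (ω i)) / n)
    (fun _ n => hmeas n) θ hv hclt hq

end CrooksPair

end Summit.Ventures.LatticeQCDFlow.Exactness.GeneralNCMC
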